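import Literature.IUT.HodgeArakelov.ThetaEvaluationSettingRmk221Proofs
import Literature.IUT.HodgeArakelov.ThetaEvaluationSettingNegative
import Literature.IUT.HodgeArakelov.ThetaEvaluationSettingR
import Mathlib.RingTheory.RootsOfUnity.Complex
import HarnessLib

/-!
# [IUTchII] Remark 2.2.1: the cell's FACT row F-1952 `Rmk221_commTerminal` DECIDED in the kernel
# (abc-iut cell, layer L6, zone [IUTchII] §2; D-0079 L-F sub-cell F6 row of `ThetaEvaluationSetting.lean`;
# typer-of-record lineage abc-iut-L6-t1; PROOF-ONLY — no definition, no instance, nothing assumed)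

S. Mochizuki, *Inter-universal Teichmüller theory II: Hodge–Arakelov-theoretic evaluation*, kurims manuscript
(Dec. 2020), §2, Remark 2.2.1 p. 67 [claim: Mochizuki2012, status: disputed] (IUTchII §2 Rmk 2.2.1, kurims p.67):
"since the subgroup `Π_{v▶} ⊆ Π_v` is commensurably terminal [cf. [IUTchI], Corollary 2.3, (iv)], it follows
that even when this subgroup is subject to a `Π_v`-conjugacy indeterminacy, the indeterminacy induced on any
specific `Π_v`-conjugate of this subgroup `Π_{v▶}` is an indeterminacy with respect to inner automorphisms";
*Inter-universal Teichmüller theory I* (May 2020), §2, Corollary 2.3 (i), (iii), (iv) pp. 47–49 ("In light of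
the exact sequences of assertion (iii), assertion (iv) follows immediately from assertion (i)", p. 49).

The statement file `Literature/IUT/HodgeArakelov/ThetaEvaluationSetting.lean` (abc-iut-L6-t1, p407103) types the
remark's INPUT as the PARAMETRISED predicate `Rmk221_commTerminal Dec := IsCommensurablyTerminal Dec.Ptri` on
the Prop. 2.2 data `Dec : SubgraphDecomposition S T D`, and PROVES the remark's deduction (`Rmk221_inner`).  The
cell's frozen FACT-LIST carries the predicate as row **F-1952** (status `fact-open`, class `parametrised`).  A
parametrised predicate is a SCHEMA: its universal closure is not a fact, and the kernel decision for the row is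
the pair ⟨universal closure REFUTED · instance form PROVED under the print-faithful guard⟩.  This file supplies
that pair and names (docstrings) the kernel objects already in the tree; nothing is re-declared.

| | statement | where |
|---|---|---|
| closure REFUTED | `not_forall_Rmk221_commTerminal` — a toy bad-place setting with `Π_v := C₂` and the trivial decomposition datum `Π_{v▶} := 1` (the free-field witness of abc-iut-L6-d1's `exists_subgraphDecomposition_trivial`); more sharply `SubgraphDecomposition.exists_not_Rmk221_commTerminal`: at EVERY Prop. 2.1/1.4 input over a non-trivial `Π_v` some `Dec` violates the row, and `exists_setting_decided_both_ways`: one setting carries data deciding the row BOTH ways | here |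
| exact content | `SubgraphDecomposition.Rmk221_commTerminal_iff_refTri` — the row holds iff the REFERENCE decomposition group `Π^tp_{X,Γ▶} ⊆ Π^tp_{X̲̲_v}` (`Dec.refTri`, [IUTchI] Cor. 2.3 (iii)) is commensurably terminal, i.e. iff [IUTchI] Cor. 2.3 (iv) holds for it | `ThetaEvaluationSettingRmk221Proofs.lean` (abc-iut-w5-d117) |
| instance form PROVED, guard = print's citation | `SubgraphDecomposition.Rmk221_commTerminal_of_cor23_i_iii` — from EXACTLY the two printed inputs of the cited [IUTchI] Cor. 2.3 (iv), stated for the reference group in the bad-place setting's own vocabulary: (i) `Π^tp_{X,Γ▶} ∩ Δ` is commensurably terminal in `Δ := Δ^tp_{X̲̲_v} = Ker(Π_v ↠ G_v)` and (iii) `Π^tp_{X,Γ▶} ↠ G_v` (abc-iut-L5's group-theoretic kernel `isCommensurablyTerminal_of_inf_ker` of that very sentence of p. 49) | here |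
| instance form, pinned reference | `SubgraphDecomposition.Rmk221_commTerminal_of_liesOver` — for a datum LYING OVER a pinned reference pair `R` (the repaired Prop. 2.2 (i)′ typing `Prop22_i'`, `ThetaEvaluationSettingR.lean`) the row is the commensurable terminality of `R.refTri` | here |
| genuine data | over identification data with an abc-iut-L5 [IUTchI] §2 datum `C` (`ℍ := Γ▶_X`, `j : Π^tp_X ≅ Π^tp_{X̲̲_v}` carrying `Π^tp_{X,ℍ}` onto `refTri`) the row follows from the TYPED [IUTchI] Cor. 2.3 (iv) resp. (i)+(iii) of `C` — `Rmk221_commTerminal_of_cor23iv_bridge` / `_of_cor23i_bridge` (abc-iut-w5-d117); at the genuine special-fibre datum `StableCurveTemperedData.ofSpecialFibre` these are `cor23iv_ofSpecialFibre_of_slim` (abc-iut-w4-d058, node IUTchI:Cor2.3(iii)/(iv), GAP row G-w4d058-1) whose standing inputs are [IUTchI] Prop. 2.2 (FACT row F-2590 `CommensuratorsOfDecompositionSubgroups`, itself resting on [CombGC] Prop. 1.2 (ii) = F-0438 `CommensurableTerminalityHolds`), the density facts of Cor. 2.3 (ii) and the slimness clause — CONDITIONAL on those owners' rows, not repeated here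 | tree, BY NAME |

So the F6 decision reads: **F-1952 = SCHEMA; universal closure REFUTED (`not_forall_Rmk221_commTerminal`); instance
form PROVED under print's own guard ([IUTchI] Cor. 2.3 (i)+(iii) for the reference group:
`Rmk221_commTerminal_of_cor23_i_iii`); genuine instance CONDITIONAL on the abc-iut-L5 node IUTchI:Cor2.3(iv) BY NAME
(`Rmk221_commTerminal_of_cor23iv_bridge`).**  The remark's OUTPUT ("an indeterminacy with respect to inner
automorphisms") is abc-iut-L6-t1's theorem `Rmk221_inner` (kernel index `N_IUTchII_Rmk2_2_1_holds`).

HONEST FRAMING.  Deciding a FACT row = OUR kernel check of OUR typed instance form; refuting a universal closure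
refutes a schema reading of a free interface field, not the paper; nothing here bears on [IUTchIII] Cor. 3.12 or
takes a side; typed ≠ proved elsewhere.  No definition, no instance, no notation, no `sorry`.
-/

noncomputable section

namespace Literature.IUT.HodgeArakelov

open Literature.AnabelianGeometry.AbsoluteAnabelian (IsCommensurablyTerminal)
open scoped Pointwise

universe u

/-! ### Plain group theory: the trivial and the whole subgroup -/

section GroupTheory

variable {G : Type u} [Group G]

/-- Every element commensurates the trivial subgroup: `C_G(1) = G`. [folklore] -/
private theorem commensurator_bot_eq_top : Subgroup.Commensurable.commensurator (⊥ : Subgroup G) = ⊤ := by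
  refine eq_top_iff.mpr fun g _ => ?_
  -- `g • 1 = 1`, and `Commensurable 1 1` is closed by the `@[refl]` lemma `Commensurable.refl`
  rw [Subgroup.Commensurable.commensurator_mem_iff, Subgroup.smul_bot]

/-- The trivial subgroup is commensurably terminal ([AbsAnab] Def. 0.1 (iii), the tree's
`IsCommensurablyTerminal`) iff the ambient group is trivial. [folklore] -/
private theorem isCommensurablyTerminal_bot_iff : IsCommensurablyTerminal (⊥ : Subgroup G) ↔ Subsingleton G := by
  constructor
  · intro h
    refine ⟨fun a b => ?_⟩
    have hmem : ∀ x : G, x ∈ (⊥ : Subgroup G) := fun x => by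
      rw [← h.commensurator_eq, commensurator_bot_eq_top]
      exact Subgroup.mem_top x
    rw [(Subgroup.mem_bot).mp (hmem a), (Subgroup.mem_bot).mp (hmem b)]
  · intro h
    haveI := h
    refine ⟨?_⟩
    rw [commensurator_bot_eq_top, Subgroup.eq_bot_iff_forall]
    exact fun x _ => Subsingleton.elim x 1

/-- In a non-trivial group the trivial subgroup is NOT commensurably terminal. [folklore] -/
private theorem not_isCommensurablyTerminal_bot [Nontrivial G] : ¬ IsCommensurablyTerminal (⊥ : Subgroup G) :=
  fun h => not_subsingleton G (isCommensurablyTerminal_bot_iff.mp h)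

/-- The whole group is commensurably terminal in itself. [folklore] -/
private theorem isCommensurablyTerminal_top : IsCommensurablyTerminal (⊤ : Subgroup G) :=
  ⟨eq_top_iff.mpr (Literature.IUT.HodgeTheaters.le_commensurator ⊤)⟩

end GroupTheory

/-! ### F-1952: the universal closure of the schema is REFUTED -/

variable {S : BadPlaceSetting.{u}} {P : TopGroup.{u}}

namespace SubgraphDecomposition

/-- **F-1952, schema reading fails at EVERY non-trivially inhabited setting.**  For any Prop. 2.1 / Prop. 1.4
input `(T, D)` over a non-trivial `Π_v`, the `SubgraphDecomposition` with `Π_{v•} = Π_{v▶} = 1`, `ι = id`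
and trivial reference groups (abc-iut-L6-d1's free-field witness `exists_subgraphDecomposition_trivial`,
RQ7 finding F4 on p407103) violates `Rmk221_commTerminal`: the trivial subgroup of a non-trivial group is
not commensurably terminal.  The reference decomposition group `refTri` is a FREE field of the landed
structure, so the typed predicate is a reading of that datum, not a property of `Π_v`.
[claim: Mochizuki2012, status: disputed] (IUTchII §2 Rmk 2.2.1, kurims p.67) -/
theorem exists_not_Rmk221_commTerminal [Nontrivial P] (T : TemperedCoverings S P)
    (D : EtaleThetaData S.toThetaSetting P) :
    ∃ Dec : SubgraphDecomposition S T D, ¬ Rmk221_commTerminal Dec := by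
  obtain ⟨Dec, -, hPtri, -⟩ := exists_subgraphDecomposition_trivial T D
  refine ⟨Dec, fun h => ?_⟩
  unfold Rmk221_commTerminal at h
  rw [hPtri] at h
  exact not_isCommensurablyTerminal_bot h

/-- … and is satisfied by the equally admissible datum whose reference group is ALL of `Π^tp_{X̲̲_v}`
(`refTri = ⊤`): the row is then the commensurable terminality of `Π_v` in itself.
[claim: Mochizuki2012, status: disputed] (IUTchII §2 Rmk 2.2.1, kurims p.67) -/
theorem Rmk221_commTerminal_of_refTri_eq_top {T : TemperedCoverings S P}
    {D : EtaleThetaData S.toThetaSetting P} (Dec : SubgraphDecomposition S T D) (h : Dec.refTri = ⊤) :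
    Rmk221_commTerminal Dec := by
  refine Dec.Rmk221_commTerminal_of_refTri ?_
  rw [h]
  exact isCommensurablyTerminal_top

end SubgraphDecomposition

/-- **F-1952 decided BOTH WAYS inside one setting** (toy): over the bad-place setting with
`Π_v = Π^tp_{X_v} = G_v := C₂` (discrete; `l = 3`, `p = 5`, `k = ℂ`, every reference subgroup `⊤`, trivial
Prop. 1.4 cohomology) the Prop. 2.2 structure admits `Dec₁` with `Π_{v▶} := Π_v` (row TRUE) and `Dec₂` with
`Π_{v▶} := 1` (row FALSE).  HONEST LABEL: a toy about the TYPING (free reference field), nothing about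
tempered fundamental groups. [claim: Mochizuki2012, status: disputed] (IUTchII §2 Rmk 2.2.1, kurims p.67) -/
theorem exists_setting_decided_both_ways :
    ∃ (S : BadPlaceSetting.{0}) (P : TopGroup.{0}) (T : TemperedCoverings S P)
      (D : EtaleThetaData S.toThetaSetting P) (Dec₁ Dec₂ : SubgraphDecomposition S T D),
      Rmk221_commTerminal Dec₁ ∧ ¬ Rmk221_commTerminal Dec₂ := by
  classical
  haveI : Fact (1 < 2) := ⟨one_lt_two⟩
  -- the toy bad-place setting: `Π_v = Π^tp_{X_v} = G_v := C₂`, everything else trivial / `⊤`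
  let C2 : TopGroup.{0} := TopGroup.of (Multiplicative (ZMod 2))
  let S : BadPlaceSetting.{0} :=
    { N := 1
      l := 3
      l_prime := Nat.prime_three
      l_odd := by norm_num
      p := 5
      p_prime := Nat.prime_five
      p_odd := by norm_num
      p_ne_l := by norm_num
      k := ℂ
      hasPrimitiveRoot := ⟨_, Complex.isPrimitiveRoot_exp 12 (by norm_num)⟩
      PiX := C2
      Gk := C2
      aug := MonoidHom.id _
      aug_continuous := continuous_id
      aug_surjective := fun x => ⟨x, rfl⟩
      modelPi := TopGroup.of PUnit.{1}
      modelD := ⊤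
      modelD_inn := le_top
      modelD_continuous := fun φ _ =>
        ⟨continuous_of_discreteTopology, continuous_of_discreteTopology⟩
      modelTheta := ∅
      PiXplain := C2
      inclPlain := MonoidHom.id _
      inclPlain_isOpenEmbedding := Topology.IsOpenEmbedding.id
      refY := ⊤
      refYdd := ⊤
      refYdd_le := le_rfl
      isOpen_refY := isOpen_discrete _
      isOpen_refYdd := isOpen_discrete _ }
  -- the Prop 2.1 diagram over `P := Π_v = C₂`, all coverings `⊤`
  let T : TemperedCoverings S C2 :=
    { isoRef := ⟨ContinuousMulEquiv.refl _⟩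
      Xplain := C2
      incl := MonoidHom.id _
      incl_isOpenEmbedding := Topology.IsOpenEmbedding.id
      Y := ⊤
      Ydd := ⊤
      Ydd_le := le_rfl
      isOpen_Y := isOpen_discrete _
      isOpen_Ydd := isOpen_discrete _
      corresponds := ⟨ContinuousMulEquiv.refl _, ContinuousMulEquiv.refl _, fun _ => rfl,
        Subgroup.map_top_of_surjective _ (MulEquiv.surjective _),
        Subgroup.map_top_of_surjective _ (MulEquiv.surjective _)⟩ }
  -- the Prop 1.4 output with trivial cohomology
  let D : EtaleThetaData S.toThetaSetting C2 :=
    { isoRef := ⟨ContinuousMulEquiv.refl _⟩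
      PiYddRef := ⊤
      PiYdd := ⊤
      isOpen_PiYdd := isOpen_discrete _
      PiYdd_corresponds := fun e => Subgroup.map_top_of_surjective _ (MulEquiv.surjective _)
      lDeltaTheta := { top := ⊥, bot := ⊥, le := le_rfl, normal := inferInstance }
      coh :=
        { H1 := fun _ => PUnit.{1}
          res := fun _ => 0
          lim := PUnit.{1}
          toLim := fun _ => 0
          toLim_res := fun _ _ => rfl }
      orbit := Set.univ
      orbit_nonempty := ⟨0, trivial⟩
      theta := Set.univ
      theta_eq := Set.ext fun _ => ⟨fun _ => ⟨0, trivial, Subsingleton.elim _ _⟩, fun _ => trivial⟩ }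
  -- `Dec₁`: every subgroup `⊤` (row TRUE)
  let Dec₁ : SubgraphDecomposition S T D :=
    { Pbullet := ⊤
      Ptri := ⊤
      bullet_le_tri := le_rfl
      tri_le_YL := fun x _ => Subgroup.mem_top _
      iota := ContinuousMulEquiv.refl _
      iota_bullet := Subgroup.map_top_of_surjective _ (MulEquiv.surjective _)
      iota_tri := Subgroup.map_top_of_surjective _ (MulEquiv.surjective _)
      iota_Ydd := Subgroup.map_top_of_surjective _ (MulEquiv.surjective _)
      refTri := ⊤
      refBullet := ⊤
      corresponds := ⟨ContinuousMulEquiv.refl _, 1,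
        by rw [Subgroup.map_top_of_surjective _ (MulEquiv.surjective _),
          Subgroup.map_top_of_surjective _ (MulEquiv.surjective _)],
        by rw [Subgroup.map_top_of_surjective _ (MulEquiv.surjective _),
          Subgroup.map_top_of_surjective _ (MulEquiv.surjective _)]⟩ }
  obtain ⟨Dec₂, hDec₂⟩ := SubgraphDecomposition.exists_not_Rmk221_commTerminal T D
  exact ⟨S, C2, T, D, Dec₁, Dec₂, isCommensurablyTerminal_top, hDec₂⟩

/-- **F-1952, universal closure REFUTED**: it is NOT the case that `Rmk221_commTerminal Dec` holds for
every bad-place setting `S`, every Prop. 2.1 / Prop. 1.4 input `(T, D)` over every `Π_v` and every Prop. 2.2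
datum `Dec` (witness: `exists_setting_decided_both_ways`).  The printed sentence is about the decomposition
group of the subgraph `Γ▶_X` ([IUTchI] Cor. 2.3 (iii)), which the typed structure carries as the free
reference field `refTri`; instance forms of record: `Rmk221_commTerminal_iff_refTri` (exact content) and
`Rmk221_commTerminal_of_cor23_i_iii` (print's guard). [claim: Mochizuki2012, status: disputed] (IUTchII §2 Rmk 2.2.1, kurims p.67) -/
theorem not_forall_Rmk221_commTerminal :
    ¬ ∀ (S : BadPlaceSetting.{0}) (P : TopGroup.{0}) (T : TemperedCoverings S P)
        (D : EtaleThetaData S.toThetaSetting P) (Dec : SubgraphDecomposition S T D),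
        Rmk221_commTerminal Dec := by
  intro h
  obtain ⟨S, P, T, D, -, Dec₂, -, h₂⟩ := exists_setting_decided_both_ways
  exact h₂ (h S P T D Dec₂)

/-! ### F-1952: the instance form PROVED under print's own guard -/

namespace SubgraphDecomposition

variable {T : TemperedCoverings S P} {D : EtaleThetaData S.toThetaSetting P}
  (Dec : SubgraphDecomposition S T D)

/-- **IUTchII:Rmk2.2.1 / F-1952, instance form — the printed justification kernel-checked**: "[cf.
[IUTchI], Corollary 2.3, (iv)]", whose proof (kurims p. 49) reads "in light of the exact sequences of
assertion (iii), assertion (iv) follows immediately from assertion (i)".  Stated for the REFERENCE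
decomposition group `Π^tp_{X,Γ▶} ⊆ Π^tp_{X̲̲_v}` (`Dec.refTri`) in the bad-place setting's own vocabulary
(`Δ := Δ^tp_{X̲̲_v} = Ker(Π^tp_{X̲̲_v} ↠ G_v)`, `ThetaSetting.DeltaX`): IF (i) `Π^tp_{X,Γ▶} ∩ Δ ⊆ Δ` is commensurably
terminal and (iii) `Π^tp_{X,Γ▶} ↠ G_v` is surjective (the exact sequence `1 → Δ_{X,ℍ} → Π_{X,ℍ} → G_k → 1`),
THEN `Π_{v▶} ⊆ Π_v` is commensurably terminal, i.e. `Rmk221_commTerminal Dec` — by abc-iut-L5's group-theoretic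
kernel of that sentence (`isCommensurablyTerminal_of_inf_ker`, `CommensuratorLemmas.lean`) and the reduction
`Rmk221_commTerminal_iff_refTri` (abc-iut-w5-d117).  PROVED; the two hypotheses are print's, nothing else.
[claim: Mochizuki2012, status: disputed] (IUTchII §2 Rmk 2.2.1, kurims p.67; IUTchI §2 Cor 2.3 (i)(iii)(iv), kurims pp.47-49) -/
theorem Rmk221_commTerminal_of_cor23_i_iii
    (hi : IsCommensurablyTerminal (Dec.refTri.subgroupOf S.DeltaX))
    (hiii : Function.Surjective (S.aug.comp Dec.refTri.subtype)) : Rmk221_commTerminal Dec :=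
  Dec.Rmk221_commTerminal_of_refTri
    ⟨Literature.IUT.HodgeTheaters.isCommensurablyTerminal_of_inf_ker S.aug Dec.refTri
      (Dec.refTri.subgroupOf S.aug.ker) hi.commensurator_eq (Subgroup.subgroupOf_map_subtype _ _).symm hiii⟩

/-- **IUTchII:Rmk2.2.1 / F-1952 at a datum LYING OVER a pinned reference** (the repaired Prop. 2.2 (i)′
typing `Prop22_i'` of `ThetaEvaluationSettingR.lean`: reference pair `R` pinned, `ι` tied to the pointed
inversion `ι₀`): the row is exactly the commensurable terminality of the pinned reference group `R.refTri`
— here the direction print uses. [claim: Mochizuki2012, status: disputed] (IUTchII §2 Prop 2.2 (i), Rmk 2.2.1, kurims pp.66-67) -/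
theorem Rmk221_commTerminal_of_liesOver {R : SubgraphReference S} {E : EnvOfGroup S.toThetaSetting P}
    {ι₀ : PointedInversion E D} (h : Dec.LiesOver R ι₀) (hR : IsCommensurablyTerminal R.refTri) :
    Rmk221_commTerminal Dec := by
  refine Dec.Rmk221_commTerminal_of_refTri ?_
  rw [h.1]
  exact hR

/-- … and conversely: at a datum lying over `R`, the row forces the commensurable terminality of `R.refTri`
(so, over a pinned reference, F-1952 IS [IUTchI] Cor. 2.3 (iv) for `Π^tp_{X,Γ▶} ⊆ Π^tp_{X̲̲_v}` — neither more
nor less). [claim: Mochizuki2012, status: disputed] (IUTchII §2 Prop 2.2 (i), Rmk 2.2.1, kurims pp.66-67) -/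
theorem isCommensurablyTerminal_refTri_of_liesOver {R : SubgraphReference S} {E : EnvOfGroup S.toThetaSetting P}
    {ι₀ : PointedInversion E D} (h : Dec.LiesOver R ι₀) (hDec : Rmk221_commTerminal Dec) :
    IsCommensurablyTerminal R.refTri := by
  rw [← h.1]
  exact (Dec.Rmk221_commTerminal_iff_refTri).mp hDec

/-- **The pinned-reference form of print's guard**: at a datum lying over `R`, [IUTchI] Cor. 2.3 (i) + (iii)
for the pinned reference group `R.refTri` give the row. [claim: Mochizuki2012, status: disputed]
(IUTchII §2 Rmk 2.2.1, kurims p.67; IUTchI §2 Cor 2.3 (i)(iii)(iv), kurims pp.47-49) -/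
theorem Rmk221_commTerminal_of_liesOver_of_cor23_i_iii {R : SubgraphReference S}
    {E : EnvOfGroup S.toThetaSetting P} {ι₀ : PointedInversion E D} (h : Dec.LiesOver R ι₀)
    (hi : IsCommensurablyTerminal (R.refTri.subgroupOf S.DeltaX))
    (hiii : Function.Surjective (S.aug.comp R.refTri.subtype)) : Rmk221_commTerminal Dec :=
  Dec.Rmk221_commTerminal_of_liesOver h
    ⟨Literature.IUT.HodgeTheaters.isCommensurablyTerminal_of_inf_ker S.aug R.refTri
      (R.refTri.subgroupOf S.aug.ker) hi.commensurator_eq (Subgroup.subgroupOf_map_subtype _ _).symm hiii⟩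

end SubgraphDecomposition

end Literature.IUT.HodgeArakelov

end
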